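import Literature.NumberTheory.LFunctions.WeilMarkovQuadratic
import Literature.NumberTheory.LFunctions.WeilGroundState
import Literature.NumberTheory.LFunctions.WeilGroundStateRealZerosProofs
import Literature.NumberTheory.LFunctions.WeilWindowSuzukiProofs
import Literature.NumberTheory.LFunctions.WeilSemilocalCompactnessProofs
import Summits.RiemannHypothesis.RiemannHypothesis.Theorems.WeilWindowFlowWindowLipschitzStubSupBoundAux

/-!
# Stub `stub_supBound` of line `cut-dont-squeeze` for crux `WeilWindowFlow.WindowLipschitz`
(item stmt-RiemannHypothesis-1039, route route-RiemannHypothesis-WeilWindowFlow; registered skeleton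
rev 4, `Summits/RiemannHypothesis/RiemannHypothesis/Cruxes/WindowLipschitz/Lines/cut-dont-squeeze.lean`)

**What is proved.** From finite energy of ground states (C2) and the weak Euler–Lagrange identity
(EL), all Weil ground states `u` of all windows `a ∈ [b₀, A] ⊂ (0, ∞)` are bounded in `L^∞` by one
constant `K(b₀, A)`: `‖u‖ ≤ K` a.e.

**Proof route** (the `δ`-decomposition maximum principle of Feulefack–Jarohs–Weth,
arXiv:2010.10448 §3, proof of Thm. 3.1 / Cor. 1.4 for the logarithmic Laplacian, transplanted to
the pure-jump Dirichlet form `𝓔_a` of the window). Test (EL) against the truncation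
`w = (Re u − c)⁺` (a `1`-Lipschitz image of `u`, so `w ∈ L²`, `w = 0` off the window and `w` has
finite energy) and take real parts. The prime atoms and the near part `t ≤ δ` of the archimedean
jump integral are non-negative by the Markov inequality `(p − q)((p−c)⁺ − (q−c)⁺) ≥ 0`; the far part
`t > δ` equals `κ_δ ⟨Re u, w⟩` minus convolution pairings bounded by `2ρ(δ)‖u‖₁ ∫w` (one Tonelli
swap, `integral_convolution`), `κ_δ = 2∫_{t>δ} ρ → ∞` as `δ → 0`; the pole term is `O_A(∫ w)`.
With `δ = δ(b₀, A)` such that `κ_δ ≥ M_A + ε(b₀) + 1 ≥ M_a + ε(a) + 1` one gets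
`c ∫ w ≤ ⟨Re u, w⟩ ≤ (c − 1) ∫ w`, so `w = 0` a.e., i.e. `Re u ≤ c`; the four phases `±1, ±i` give
`‖u‖ ≤ 2c`.

## References

* P. A. Feulefack, S. Jarohs, T. Weth, *Small order asymptotics of the Dirichlet eigenvalue
  problem for the fractional Laplacian*, J. Fourier Anal. Appl. 28 (2022), arXiv:2010.10448, §3.
-/

set_option linter.dupNamespace false

noncomputable section

open MeasureTheory Set Filter
open scoped Topology ENNReal NNReal ComplexConjugate

namespace Summit.RiemannHypothesis.RiemannHypothesis.Theorems.WeilWindowFlowWindowLipschitz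

open Literature.NumberTheory.LFunctions

/-! ## The truncation `(Re u − c)⁺` -/

/-- The truncation `z ↦ ((Re z − c)⁺ : ℂ)` is `1`-Lipschitz. [folklore] -/
private theorem stub_supBound_lipschitz_trunc (c : ℝ) :
    LipschitzWith 1 (fun z : ℂ ↦ ((max (z.re - c) 0 : ℝ) : ℂ)) := by
  refine LipschitzWith.of_dist_le_mul fun z w ↦ ?_
  rw [NNReal.coe_one, one_mul, Complex.dist_eq, ← Complex.ofReal_sub, Complex.norm_real,
    Real.norm_eq_abs, Complex.dist_eq]
  calc |max (z.re - c) 0 - max (w.re - c) 0| ≤ |(z.re - c) - (w.re - c)| :=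
        abs_max_sub_max_le_abs _ _ _
    _ = |(z - w).re| := by rw [Complex.sub_re]; ring_nf
    _ ≤ ‖z - w‖ := Complex.abs_re_le_norm _

/-- **Markov inequality** for the truncation: `(p − q)((p−c)⁺ − (q−c)⁺) ≥ 0`. [folklore] -/
private theorem stub_supBound_markov (p q c : ℝ) :
    0 ≤ (p - q) * (max (p - c) 0 - max (q - c) 0) := by
  rcases le_total q p with h | h
  · exact mul_nonneg (sub_nonneg.2 h) (sub_nonneg.2 (max_le_max (sub_le_sub_right h c) le_rfl))
  · exact mul_nonneg_of_nonpos_of_nonpos (sub_nonpos.2 h)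
      (sub_nonpos.2 (max_le_max (sub_le_sub_right h c) le_rfl))

/-- `c (p−c)⁺ ≤ p (p−c)⁺`. [folklore] -/
private theorem stub_supBound_mul_trunc_le (p c : ℝ) : c * max (p - c) 0 ≤ p * max (p - c) 0 := by
  rcases le_total c p with h | h
  · rw [max_eq_left (sub_nonneg.2 h)]
    nlinarith
  · rw [max_eq_right (sub_nonpos.2 h)]
    simp

/-! ## The pieces of the real part of the Euler–Lagrange identity -/

/-- **The pole term is `O_A(‖u‖₁ ‖W‖₁)`**: for `u`, `W` vanishing off `[-a, a] ⊆ [-A, A]`,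
`Re[2(∫u ch)conj(∫W ch)] − Re[2(∫u sh)conj(∫W sh)] ≥ −4e^{2A}‖u‖₁‖W‖₁`. [folklore] -/
private theorem stub_supBound_pole_re_lower {u : ℝ → ℂ} {W : ℝ → ℝ} {a A : ℝ} (haA : a ≤ A)
    (hu1 : Integrable u) (hu0 : ∀ x, x ∉ Icc (-a) a → u x = 0)
    (hW1 : Integrable (fun x ↦ (W x : ℂ))) (hW0 : ∀ x, x ∉ Icc (-a) a → W x = 0) :
    -(4 * Real.exp A ^ 2 * (∫ x, ‖u x‖) * ∫ x, ‖(W x : ℂ)‖) ≤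
      (2 * (∫ x, u x * (Real.cosh (x / 2) : ℂ)) *
          conj (∫ x, (W x : ℂ) * (Real.cosh (x / 2) : ℂ))).re -
      (2 * (∫ x, u x * (Real.sinh (x / 2) : ℂ)) *
          conj (∫ x, (W x : ℂ) * (Real.sinh (x / 2) : ℂ))).re := by
  have hWC0 : ∀ x, x ∉ Icc (-a) a → (W x : ℂ) = 0 := fun x hx ↦ by
    rw [hW0 x hx, Complex.ofReal_zero]
  have b1 := stub_supBound_norm_integral_mul_le hu1 hu0
    (fun x hx ↦ (stub_supBound_cosh_sinh_le haA hx).1)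
  have b2 := stub_supBound_norm_integral_mul_le hW1 hWC0
    (fun x hx ↦ (stub_supBound_cosh_sinh_le haA hx).1)
  have b3 := stub_supBound_norm_integral_mul_le hu1 hu0
    (fun x hx ↦ (stub_supBound_cosh_sinh_le haA hx).2)
  have b4 := stub_supBound_norm_integral_mul_le hW1 hWC0
    (fun x hx ↦ (stub_supBound_cosh_sinh_le haA hx).2)
  have hNu : 0 ≤ ∫ x, ‖u x‖ := integral_nonneg fun _ ↦ norm_nonneg _
  have key : ∀ I₁ I₂ : ℂ, ‖I₁‖ ≤ Real.exp A * ∫ x, ‖u x‖ → ‖I₂‖ ≤ Real.exp A * ∫ x, ‖(W x : ℂ)‖ →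
      |(2 * I₁ * conj I₂).re| ≤ 2 * Real.exp A ^ 2 * (∫ x, ‖u x‖) * ∫ x, ‖(W x : ℂ)‖ := by
    intro I₁ I₂ h1 h2
    calc |(2 * I₁ * conj I₂).re| ≤ ‖2 * I₁ * conj I₂‖ := Complex.abs_re_le_norm _
      _ = 2 * (‖I₁‖ * ‖I₂‖) := by
          rw [norm_mul, norm_mul, Complex.norm_conj, Complex.norm_two]
          ring
      _ ≤ 2 * ((Real.exp A * ∫ x, ‖u x‖) * (Real.exp A * ∫ x, ‖(W x : ℂ)‖)) :=
          mul_le_mul_of_nonneg_left (mul_le_mul h1 h2 (norm_nonneg _)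
            (mul_nonneg (Real.exp_pos A).le hNu)) two_pos.le
      _ = 2 * Real.exp A ^ 2 * (∫ x, ‖u x‖) * ∫ x, ‖(W x : ℂ)‖ := by ring
  have k1 := key _ _ b1 b2
  have k2 := key _ _ b3 b4
  rw [abs_le] at k1 k2
  linarith [k1.1, k2.2]

/-- **The prime atoms are non-negative** against a Markov test function. [folklore] -/
private theorem stub_supBound_sum_re_nonneg {u : ℝ → ℂ} {W : ℝ → ℝ} (hu : MemLp u 2)
    (hW : MemLp (fun x ↦ (W x : ℂ)) 2)
    (hmk : ∀ p q, 0 ≤ ((u p).re - (u q).re) * (W p - W q)) (s : Finset ℕ) :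
    0 ≤ (∑ n ∈ s, (((ArithmeticFunction.vonMangoldt n : ℝ) / Real.sqrt n : ℝ) : ℂ) *
      ∫ x, (u (x + Real.log n) - u x) *
        conj (((W (x + Real.log n) : ℝ) : ℂ) - ((W x : ℝ) : ℂ))).re := by
  rw [Complex.re_sum]
  refine Finset.sum_nonneg fun n _ ↦ ?_
  rw [Complex.re_ofReal_mul, stub_supBound_re_crossIncrement hu hW]
  exact mul_nonneg (div_nonneg ArithmeticFunction.vonMangoldt_nonneg (Real.sqrt_nonneg _))
    (integral_nonneg fun x ↦ hmk _ _)

/-- **The archimedean term, split at `δ`**: near part `≥ 0` (Markov), far part expanded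
(`stub_supBound_far_lower`):
`κ_δ ⟨Re u, W⟩ − 2ρ(δ)‖Re u‖₁‖W‖₁ ≤ Re ∫₀^∞ ρ(t) ∫ (u(x+t) − u x) conj(W(x+t) − W x) dx dt`.
[folklore] -/
private theorem stub_supBound_arch_lower {u : ℝ → ℂ} {W : ℝ → ℝ} (hu : MemLp u 2)
    (hu1 : Integrable u) (hW : MemLp (fun x ↦ (W x : ℂ)) 2) (hW1 : Integrable W)
    (hfu : IntegrableOn (fun t ↦ weilArchDensity t * weilIncrement u t) (Ioi 0))
    (hfw : IntegrableOn (fun t ↦ weilArchDensity t * weilIncrement (fun x ↦ (W x : ℂ)) t) (Ioi 0))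
    (hmk : ∀ p q, 0 ≤ ((u p).re - (u q).re) * (W p - W q)) {δ : ℝ} (hδ : 0 < δ) :
    (2 * ∫ t in Ioi δ, weilArchDensity t) * (∫ x, (u x).re * W x) -
        2 * (weilArchDensity δ * ((∫ x, |(u x).re|) * ∫ x, |W x|)) ≤
      (∫ t in Ioi (0 : ℝ), (weilArchDensity t : ℂ) *
        ∫ x, (u (x + t) - u x) * conj (((W (x + t) : ℝ) : ℂ) - ((W x : ℝ) : ℂ))).re := by
  obtain ⟨hDint, hre⟩ := stub_supBound_arch_re hu hW hfu hfw
  rw [hre]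
  have hsplit : ∫ t in Ioi (0 : ℝ), weilArchDensity t *
        ∫ x, ((u (x + t)).re - (u x).re) * (W (x + t) - W x) =
      (∫ t in Ioc (0 : ℝ) δ, weilArchDensity t *
          ∫ x, ((u (x + t)).re - (u x).re) * (W (x + t) - W x)) +
        ∫ t in Ioi δ, weilArchDensity t *
          ∫ x, ((u (x + t)).re - (u x).re) * (W (x + t) - W x) := by
    rw [← Ioc_union_Ioi_eq_Ioi hδ.le, setIntegral_union (Ioc_disjoint_Ioi le_rfl)
      measurableSet_Ioi (hDint.mono_set Ioc_subset_Ioi_self)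
      (hDint.mono_set (Ioi_subset_Ioi hδ.le))]
  have hnear : 0 ≤ ∫ t in Ioc (0 : ℝ) δ, weilArchDensity t *
      ∫ x, ((u (x + t)).re - (u x).re) * (W (x + t) - W x) :=
    setIntegral_nonneg measurableSet_Ioc fun t ht ↦
      mul_nonneg (weilArchDensity_pos ht.1).le (integral_nonneg fun x ↦ hmk _ _)
  have hV : MemLp (fun x ↦ (u x).re) 2 := by simpa using hu.re
  have hWr : MemLp W 2 := by simpa using hW.re
  have hV1 : Integrable (fun x ↦ (u x).re) := by simpa using hu1.re
  have hfar := stub_supBound_far_lower hV hWr hV1 hW1 hδ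
  rw [hsplit]
  linarith

/-- `‖u‖₁ ≤ a + 1/2` for a ground state of the window `[-a, a]` (`|u| ≤ (1 + |u|²)/2` on the window,
`∫|u|² = 1`). [folklore] -/
private theorem stub_supBound_l1_le {a : ℝ} {u : ℝ → ℂ} (hu : IsWeilGroundState a u)
    (hu0 : ∀ x, x ∉ Icc (-a) a → u x = 0) : ∫ x, ‖u x‖ ≤ a + 1 / 2 := by
  have ha := hu.pos
  have h2 : Integrable (fun x ↦ ‖u x‖ ^ 2) :=
    (memLp_two_iff_integrable_sq_norm hu.memLp.1).1 hu.memLp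
  have hind : Integrable ((Icc (-a) a).indicator (fun _ ↦ (1 : ℝ))) :=
    (integrable_indicator_iff measurableSet_Icc).2
      (integrableOn_const (by rw [Real.volume_Icc]; exact ENNReal.ofReal_ne_top))
  calc ∫ x, ‖u x‖ ≤ ∫ x, ((Icc (-a) a).indicator (fun _ ↦ (1 : ℝ)) x + ‖u x‖ ^ 2) / 2 := by
        refine integral_mono hu.integrable.norm ((hind.add h2).div_const 2) fun x ↦ ?_
        by_cases hx : x ∈ Icc (-a) a
        · dsimp only
          rw [indicator_of_mem hx]
          nlinarith [sq_nonneg (‖u x‖ - 1)]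
        · simp [hu0 x hx, hx]
    _ = (volume.real (Icc (-a) a) + ∫ x, ‖u x‖ ^ 2) / 2 := by
        rw [integral_div, integral_add hind h2, integral_indicator_const _ measurableSet_Icc,
          smul_eq_mul, mul_one]
    _ = a + 1 / 2 := by
        rw [hu.integral_norm_sq, Real.volume_real_Icc_of_le (by linarith)]
        ring

/-! ## One phase: `Re u ≤ c` a.e. -/

/-- **The maximum principle for one phase.** Under (C2) and (EL), for a ground state `u` of a
window `a ∈ [b₀, A]` vanishing off the window, and `δ` with `2∫_{Ioi δ} ρ ≥ M_A + ε(b₀) + 1`: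
`Re u ≤ c(A, δ)` a.e., `c = 4e^{2A}(A + 1/2) + 2ρ(δ)(A + 1/2) + 1` (test (EL) against
`(Re u − c)⁺`; Feulefack–Jarohs–Weth, arXiv:2010.10448 §3). [folklore] -/
private theorem stub_supBound_phase
    (hC2 : ∀ (a : ℝ) (u : ℝ → ℂ), IsWeilGroundState a u →
      IntegrableOn (fun t ↦ weilArchDensity t * weilIncrement u t) (Ioi 0) ∧
        weilPoleForm u + weilDirichletEnergy a u ≤
          (weilMarkovConstant a + weilGroundEnergy a) * ∫ x, ‖u x‖ ^ 2)
    (hEL : ∀ (a : ℝ) (u : ℝ → ℂ), IsWeilGroundState a u →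
      ∀ w : ℝ → ℂ, MemLp w 2 → (∀ᵐ x : ℝ, x ∉ Icc (-a) a → w x = 0) →
        IntegrableOn (fun t ↦ weilArchDensity t * weilIncrement w t) (Ioi 0) →
        2 * (∫ x, u x * (Real.cosh (x / 2) : ℂ)) *
              (starRingEnd ℂ) (∫ x, w x * (Real.cosh (x / 2) : ℂ))
          - 2 * (∫ x, u x * (Real.sinh (x / 2) : ℂ)) *
              (starRingEnd ℂ) (∫ x, w x * (Real.sinh (x / 2) : ℂ))
          + (∑ n ∈ weilPrimeIndex a,
              (((ArithmeticFunction.vonMangoldt n : ℝ) / Real.sqrt n : ℝ) : ℂ) *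
                ∫ x, (u (x + Real.log n) - u x) * (starRingEnd ℂ) (w (x + Real.log n) - w x))
          + (∫ t in Ioi (0 : ℝ), (weilArchDensity t : ℂ) *
              ∫ x, (u (x + t) - u x) * (starRingEnd ℂ) (w (x + t) - w x))
          - (weilMarkovConstant a : ℂ) * ∫ x, u x * (starRingEnd ℂ) (w x)
        = (weilGroundEnergy a : ℂ) * ∫ x, u x * (starRingEnd ℂ) (w x))
    {b₀ A a δ : ℝ} (hb₀ : 0 < b₀) (hba : b₀ ≤ a) (haA : a ≤ A) (hδ : 0 < δ)
    (hκ : weilMarkovConstant A + weilGroundEnergy b₀ + 1 ≤ 2 * ∫ t in Ioi δ, weilArchDensity t)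
    {u : ℝ → ℂ} (hu : IsWeilGroundState a u) (hu0 : ∀ x, x ∉ Icc (-a) a → u x = 0) :
    ∀ᵐ x : ℝ, (u x).re ≤
      4 * Real.exp A ^ 2 * (A + 1 / 2) + 2 * (weilArchDensity δ * (A + 1 / 2)) + 1 := by
  set N : ℝ := A + 1 / 2 with hN
  set c : ℝ := 4 * Real.exp A ^ 2 * N + 2 * (weilArchDensity δ * N) + 1 with hc
  have hN0 : 0 ≤ N := by rw [hN]; linarith
  have hρδ : 0 ≤ weilArchDensity δ := (weilArchDensity_pos hδ).le
  have heA : 0 ≤ Real.exp A ^ 2 := sq_nonneg _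
  have hc1 : 1 ≤ c := by
    have h1 : 0 ≤ 4 * Real.exp A ^ 2 * N := by positivity
    have h2 : 0 ≤ 2 * (weilArchDensity δ * N) := by positivity
    linarith
  have hc0 : 0 < c := by linarith
  -- the test function `W = (Re u − c)⁺`
  set W : ℝ → ℝ := fun x ↦ max ((u x).re - c) 0 with hW
  have hW0 : ∀ x, 0 ≤ W x := fun x ↦ le_max_right _ _
  have hWsupp : ∀ x, x ∉ Icc (-a) a → W x = 0 := fun x hx ↦ by
    simp only [hW, hu0 x hx, Complex.zero_re, zero_sub]
    exact max_eq_right (by linarith)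
  have hΦ := stub_supBound_lipschitz_trunc c
  have hΦ0 : (fun z : ℂ ↦ ((max (z.re - c) 0 : ℝ) : ℂ)) 0 = 0 := by
    simp only [Complex.zero_re, zero_sub, Complex.ofReal_eq_zero]
    exact max_eq_right (by linarith)
  have hWC : MemLp (fun x ↦ ((W x : ℝ) : ℂ)) 2 := (hΦ.comp_memLp hΦ0 hu.memLp :)
  have hWCsupp : ∀ᵐ x : ℝ, x ∉ Icc (-a) a → ((W x : ℝ) : ℂ) = 0 :=
    Eventually.of_forall fun x hx ↦ by rw [hWsupp x hx, Complex.ofReal_zero]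
  have hfinU := (hC2 a u hu).1
  have hDle : ∀ t, weilIncrement (fun x ↦ ((W x : ℝ) : ℂ)) t ≤ weilIncrement u t := fun t ↦
    (weilIncrement_comp_le hΦ (integrable_weilIncrement_integrand hu.memLp t) :)
  have hfinW : IntegrableOn
      (fun t ↦ weilArchDensity t * weilIncrement (fun x ↦ ((W x : ℝ) : ℂ)) t) (Ioi 0) := by
    refine Integrable.mono' hfinU
      (measurable_weilArchDensity.aestronglyMeasurable.mul
        (stub_supBound_aesm_weilIncrement hWC.1).restrict) ?_
    refine (ae_restrict_iff' measurableSet_Ioi).2 (Eventually.of_forall fun t (ht : 0 < t) ↦ ?_)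
    rw [Real.norm_of_nonneg (mul_nonneg (weilArchDensity_pos ht).le (weilIncrement_nonneg _ t))]
    exact mul_le_mul_of_nonneg_left (hDle t) (weilArchDensity_pos ht).le
  -- integrability of `u`, `W`
  have hu1 : Integrable u := hu.integrable
  have hWC1 : Integrable (fun x ↦ ((W x : ℝ) : ℂ)) := by
    refine Integrable.mono' hu1.norm hWC.1 (Eventually.of_forall fun x ↦ ?_)
    rw [Complex.norm_real, Real.norm_of_nonneg (hW0 x)]
    exact max_le (by linarith [Complex.abs_re_le_norm (u x), le_abs_self ((u x).re)])
      (norm_nonneg _)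
  have hW1 : Integrable W := by simpa using hWC1.re
  have hmk : ∀ p q, 0 ≤ ((u p).re - (u q).re) * (W p - W q) := fun p q ↦
    stub_supBound_markov _ _ c
  -- the Euler–Lagrange identity against `W`, real part
  have hid := hEL a u hu (fun x ↦ ((W x : ℝ) : ℂ)) hWC hWCsupp hfinW
  have hre := congrArg Complex.re hid
  simp only [Complex.sub_re, Complex.add_re, Complex.re_ofReal_mul] at hre
  have hpair : (∫ x, u x * conj ((W x : ℝ) : ℂ)).re = ∫ x, (u x).re * W x :=
    stub_supBound_re_integral_mul_conj_ofReal (hu.memLp.integrable_mul hWC)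
  rw [hpair] at hre
  have hpole := stub_supBound_pole_re_lower haA hu1 hu0 hWC1 hWsupp
  have hsum := stub_supBound_sum_re_nonneg hu.memLp hWC hmk (weilPrimeIndex a)
  have harch := stub_supBound_arch_lower hu.memLp hu1 hWC hW1 hfinU hfinW hmk hδ
  -- the numbers
  have hS0 : 0 ≤ ∫ x, W x := integral_nonneg hW0
  have hNW : ∫ x, ‖((W x : ℝ) : ℂ)‖ = ∫ x, W x :=
    integral_congr_ae (Eventually.of_forall fun x ↦ by
      show ‖((W x : ℝ) : ℂ)‖ = W x
      rw [Complex.norm_real, Real.norm_of_nonneg (hW0 x)])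
  have hNW' : ∫ x, |W x| = ∫ x, W x :=
    integral_congr_ae (Eventually.of_forall fun x ↦ abs_of_nonneg (hW0 x))
  have hNu : ∫ x, ‖u x‖ ≤ N := (stub_supBound_l1_le hu hu0).trans (by rw [hN]; linarith)
  have hNv : ∫ x, |(u x).re| ≤ N :=
    (integral_mono hu1.re.abs hu1.norm fun x ↦ Complex.abs_re_le_norm (u x)).trans hNu
  have hVWc : c * ∫ x, W x ≤ ∫ x, (u x).re * W x := by
    rw [← integral_const_mul]
    exact integral_mono (hW1.const_mul c) (by simpa using (hu.memLp.integrable_mul hWC).re)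
      fun x ↦ stub_supBound_mul_trunc_le _ c
  have hM : weilMarkovConstant a ≤ weilMarkovConstant A := stub_supBound_weilMarkovConstant_mono haA
  have hε : weilGroundEnergy a ≤ weilGroundEnergy b₀ := stub_supBound_weilGroundEnergy_anti hb₀ hba
  rw [hNW] at hpole
  rw [hNW'] at harch
  have hp1 : 4 * Real.exp A ^ 2 * (∫ x, ‖u x‖) * (∫ x, W x) ≤
      4 * Real.exp A ^ 2 * N * ∫ x, W x :=
    mul_le_mul_of_nonneg_right (mul_le_mul_of_nonneg_left hNu (by positivity)) hS0
  have hp2 : 2 * (weilArchDensity δ * ((∫ x, |(u x).re|) * ∫ x, W x)) ≤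
      2 * (weilArchDensity δ * (N * ∫ x, W x)) :=
    mul_le_mul_of_nonneg_left (mul_le_mul_of_nonneg_left
      (mul_le_mul_of_nonneg_right hNv hS0) hρδ) two_pos.le
  have hVW0 : 0 ≤ ∫ x, (u x).re * W x := le_trans (mul_nonneg hc0.le hS0) hVWc
  have hp3 : 0 ≤ (2 * (∫ t in Ioi δ, weilArchDensity t) - weilMarkovConstant a -
      weilGroundEnergy a - 1) * ∫ x, (u x).re * W x :=
    mul_nonneg (by linarith) hVW0
  have hSz : ∫ x, W x = 0 := by
    apply le_antisymm _ hS0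
    nlinarith [hre, hpole, hsum, harch, hVWc, hp1, hp2, hp3]
  -- conclusion
  have hWae : W =ᵐ[volume] 0 := (integral_eq_zero_iff_of_nonneg hW0 hW1).1 hSz
  filter_upwards [hWae] with x hx
  have hx' : max ((u x).re - c) 0 = 0 := hx
  linarith [le_max_left ((u x).re - c) 0]

/-! ## The theorem -/

/-- **Uniform `L^∞` bound for Weil ground states on compact window ranges.** Assuming finite
energy of ground states (C2) and the weak Euler–Lagrange identity (EL), for `0 < b₀ ≤ A` there is
`K = K(b₀, A)` with `‖u‖ ≤ K` a.e. for every ground state `u` of every window `a ∈ [b₀, A]`.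
Proof: the `δ`-decomposition maximum principle (Feulefack–Jarohs–Weth, arXiv:2010.10448 §3,
proof of Thm. 3.1; Cor. 1.4 for the logarithmic Laplacian): choose `δ` with
`2∫_{Ioi δ} ρ ≥ M_A + ε(b₀) + 1` (`stub_supBound_exists_delta`; `M_a ≤ M_A`, `ε(a) ≤ ε(b₀)`), apply
`stub_supBound_phase` to the four phases `ζu`, `ζ ∈ {1, −1, i, −i}`, of the truncated ground state,
and use `‖z‖ ≤ |Re z| + |Im z|`. -/
theorem stub_supBound :
    (∀ (a : ℝ) (u : ℝ → ℂ), IsWeilGroundState a u →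
      IntegrableOn (fun t ↦ weilArchDensity t * weilIncrement u t) (Ioi 0) ∧
        weilPoleForm u + weilDirichletEnergy a u ≤
          (weilMarkovConstant a + weilGroundEnergy a) * ∫ x, ‖u x‖ ^ 2) →
    (∀ (a : ℝ) (u : ℝ → ℂ), IsWeilGroundState a u →
      ∀ w : ℝ → ℂ, MemLp w 2 → (∀ᵐ x : ℝ, x ∉ Icc (-a) a → w x = 0) →
        IntegrableOn (fun t ↦ weilArchDensity t * weilIncrement w t) (Ioi 0) →
        2 * (∫ x, u x * (Real.cosh (x / 2) : ℂ)) * (starRingEnd ℂ) (∫ x, w x * (Real.cosh (x / 2) : ℂ))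
          - 2 * (∫ x, u x * (Real.sinh (x / 2) : ℂ)) * (starRingEnd ℂ) (∫ x, w x * (Real.sinh (x / 2) : ℂ))
          + (∑ n ∈ weilPrimeIndex a, (((ArithmeticFunction.vonMangoldt n : ℝ) / Real.sqrt n : ℝ) : ℂ) *
              ∫ x, (u (x + Real.log n) - u x) * (starRingEnd ℂ) (w (x + Real.log n) - w x))
          + (∫ t in Ioi (0 : ℝ), (weilArchDensity t : ℂ) *
              ∫ x, (u (x + t) - u x) * (starRingEnd ℂ) (w (x + t) - w x))
          - (weilMarkovConstant a : ℂ) * ∫ x, u x * (starRingEnd ℂ) (w x)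
        = (weilGroundEnergy a : ℂ) * ∫ x, u x * (starRingEnd ℂ) (w x)) →
    ∀ b₀ A : ℝ, 0 < b₀ → b₀ ≤ A → ∃ K : ℝ, ∀ (a : ℝ) (u : ℝ → ℂ), b₀ ≤ a → a ≤ A →
      IsWeilGroundState a u → ∀ᵐ x : ℝ, ‖u x‖ ≤ K := by
  intro hC2 hEL b₀ A hb₀ hbA
  obtain ⟨δ, hδ, hκ⟩ :=
    stub_supBound_exists_delta (weilMarkovConstant A + weilGroundEnergy b₀ + 1)
  set c : ℝ := 4 * Real.exp A ^ 2 * (A + 1 / 2) + 2 * (weilArchDensity δ * (A + 1 / 2)) + 1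
  refine ⟨2 * c, fun a u hba haA hu ↦ ?_⟩
  set u' : ℝ → ℂ := (Icc (-a) a).indicator u with hu'
  have hgs : IsWeilGroundState a u' := hu.congr_ae hu.ae_eq_indicator
  have hu'0 : ∀ x, x ∉ Icc (-a) a → u' x = 0 := fun x hx ↦ indicator_of_notMem hx _
  have key : ∀ ζ : ℂ, ‖ζ‖ = 1 → ∀ᵐ x : ℝ, (ζ * u' x).re ≤ c := fun ζ hζ ↦
    stub_supBound_phase hC2 hEL hb₀ hba haA hδ hκ (hgs.const_mul hζ)
      (fun x hx ↦ by rw [hu'0 x hx, mul_zero])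
  have h1 := key 1 (by simp)
  have h2 := key (-1) (by simp)
  have h3 := key Complex.I (by simp)
  have h4 := key (-Complex.I) (by simp)
  filter_upwards [h1, h2, h3, h4, hu.ae_eq_indicator] with x h1 h2 h3 h4 hx
  rw [hx]
  simp only [one_mul, neg_mul, Complex.neg_re, Complex.mul_re, Complex.I_re, Complex.I_im,
    zero_mul, one_mul, zero_sub] at h1 h2 h3 h4
  calc ‖u' x‖ ≤ |(u' x).re| + |(u' x).im| := Complex.norm_le_abs_re_add_abs_im _
    _ ≤ c + c := add_le_add (abs_le.2 ⟨by linarith, h1⟩) (abs_le.2 ⟨by linarith, by linarith⟩)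
    _ = 2 * c := by ring

end Summit.RiemannHypothesis.RiemannHypothesis.Theorems.WeilWindowFlowWindowLipschitz

end
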